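import Literature.MathematicalPhysics.QuantumLattice.AnisotropicXYGaussianDomination
import Literature.MathematicalPhysics.QuantumLattice.HeisenbergOrderNeelGD
import HarnessLib

/-!
# Gaussian domination for the Heisenberg antiferromagnet with direction-dependent
# (reflection-invariant) couplings — Kennedy–Lieb–Shastry's model (5)

Topic `MathematicalPhysics/QuantumLattice`; companion of `HeisenbergOrderNeelGD.lean` (ground
state, uniform coupling), `HeisenbergOrderDLSGaussianDomination.lean` (positive temperature,
uniform coupling) and `AnisotropicXYGaussianDomination.lean` (the XY version of the present file,
whose `TODO(general form)` this file carries out). No named fact is introduced; everything here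
is a theorem.

## What is printed

Kennedy, Lieb and Shastry, J. Stat. Phys. **53** (1988) 1019–1030, p. 1023, eq. (5):
`H = Σ_{⟨xy⟩} J_{xy} 𝐒_x·𝐒_y`, "where the coupling constant `J_{xy}` equals 1 for bonds `{xy}` in
one of the first two coordinate directions and equals `r` for bonds in the third coordinate
direction. We will prove that this model has Néel order if `1 ≥ r ≥ 0.16` and `S = 1/2`";
p. 1026: "For the model (5) which interpolates between two and three dimensions, the bound (14)
holds with `E_{q-Q}` replaced by `E^r_{q-Q}`" — i.e. the ground-state **Gaussian domination**
`E(h) ≥ E(0)` of eq. (18) for the field Hamiltonian (17)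
`H(h) = ½Σ_{⟨xy⟩}[(T¹_x - T¹_y)² + (T²_x - T²_y)² + (T³_x - T³_y - h_x + h_y)²]` (after the
sublattice rotation (15)–(16)), and its proof by reflection positivity in the planes through a
bond and the descent on the number of bonds with `h_x ≠ h_y` (pp. 1027–1029, eqs. (20)–(25)),
hold verbatim for the direction-dependent couplings of (5): the reflection through planes
perpendicular to direction `j` maps every bond to a bond of the same direction, the two
half-space Hamiltonians are mirror images, and each crossing bond carries a nonnegative coupling.
P. 1020: "(Although we only consider the ground states of these models, the techniques we use may
be combined with the techniques of Dyson et al. for nonzero temperatures …)" — the positive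
temperature version, Dyson–Lieb–Simon, J. Stat. Phys. **18** (1978), Lemma 4.1 and Thm. 4.2,
is carried along.

## Contents (all `d`, all spins `S = n/2`, even side `L ≥ 4`)

For a weight `w` on the bonds of the torus `(ℤ/Lℤ)^d`, nonnegative and invariant under the
reflections through bond planes (the case of record being `dirCoupling K`, `w{x, x+eᵢ} = Kᵢ ≥ 0`):

* `heisFieldBond`, `heisWeightedHamiltonian L n w = Σ_{⟨xy⟩} w_{xy} 𝐒_x·𝐒_y`,
  `heisWeightedFieldHamiltonian L n w h = Σ_{⟨xy⟩} w_{xy}[𝐒_x·𝐒_y - (h_x - h_y)(S̃¹_x - S̃¹_y)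
  + ½(h_x - h_y)²]` (eq. (17) in the original frame, staggered first component `S̃¹ = (-1)^x S¹`,
  as in the tree's `heisFieldHamiltonian`), and the rotated real form
  `heisWeightedRealFieldHamiltonian` with bond terms `heisRealBond = xyRealBond - S³S³`
  ([DLS1978] (41b));
* `heisWeightedRealFieldHamiltonian_eq_submatrix` — the Kronecker form (21)
  `H♭_w(g) = A ⊗ 1 + 1 ⊗ B - Σᵢ Mᵢ ⊗ Nᵢ` along every pair of planes, with the weight `√w` of the
  crossing bond on `Mᵢ`, `Nᵢ` (three real crossing operators per crossing bond);
* `exists_unitary_conj_heisFieldBond` — the sublattice rotation by `π` about the `2`-axis as ONE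
  unitary conjugating every bond term `{x,y}` of the torus graph into its real form
  (eqs. (15)–(16)), whence `groundEnergy_heisWeightedFieldHamiltonian_eq`,
  `partitionFn_heisWeightedFieldHamiltonian_eq`;
* `heis_groundEnergy_reflect_le_weighted` — `½E_w(h^L) + ½E_w(h^R) ≤ E_w(h)`
  (`Matrix.kls_groundEnergy_reflection`); `heis_partitionFn_weighted_sq_le` —
  `Z_w(h)² ≤ Z_w(h^L)Z_w(h^R)` ([DLS1978] Lemma 4.1, `Matrix.trace_exp_kroneckerSum_le`);
* **`gaussianDomination_descent`** — the descent of pp. 1027–1029 ONCE, for an arbitrary real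
  function `E` of the field with the reflection inequality and `E(h) = E(0)` for fields constant on
  bonds (the tree proves this descent anew in each Gaussian-domination file; here it is isolated);
* **`heisWeighted_gaussianDomination_ground`** — `E₀(H_w) ≤ E₀(H_w(h))` ([KLS1988JSP] (18)) and
  **`partitionFn_heisWeightedField_le`** — `Z_β(H_w(h)) ≤ Z_β(H_w)` ([DLS1978] Thm. 4.2);
* the direction-dependent couplings: `heisAnisoTorus L n K = Σ_x Σᵢ Kᵢ 𝐒_x·𝐒_{x+eᵢ}`
  (`heisAnisoTorus_eq_sum`, `heisAnisoTorus_one = heisenbergTorus d L n 1`), the field Hamiltonian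
  `heisAnisoFieldHamiltonian` with `heisAnisoFieldHamiltonian_eq : H_K(h) = H_K - V_K(h) + ½Q_K(h)`
  (`heisAnisoStagGradField`, `xyAnisoFieldEnergy`), and the two Gaussian domination theorems for
  it, `heisAniso_gaussianDomination_ground`, `partitionFn_heisAnisoField_le`; the isotropic
  special case recovers the tree's `heis_gaussianDomination_ground`.

## References

* [KLS1988JSP] T. Kennedy, E. H. Lieb, B. S. Shastry, *Existence of Néel order in some spin-1/2
  Heisenberg antiferromagnets*, J. Stat. Phys. 53 (1988) 1019–1030: p. 1020, eqs. (5)–(9)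
  (p. 1023), (14)–(25) (pp. 1026–1029) (read in: E. H. Lieb, *Statistical Mechanics (Selecta)*,
  paper IV.7).
* [DLS1978] F. J. Dyson, E. H. Lieb, B. Simon, J. Stat. Phys. 18 (1978) 335–383, Lemma 4.1,
  Thm. 4.2, Lemma 6.1, Thm. 6.1.
-/

noncomputable section

open Matrix Finset NormedSpace
open scoped ComplexOrder Kronecker
open Literature.MathematicalPhysics.QuantumLattice Literature.MathematicalPhysics.QuantumLattice.SpinOperators
  Literature.Probability.LatticeModels Literature.Barriers.AtomisticToContinuum.BoseGas

namespace Literature.MathematicalPhysics.QuantumLattice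

variable {d : ℕ}

/-! ### The bond terms and the weighted Hamiltonians -/

section Defs

variable {Λ : Type*} [Fintype Λ] [DecidableEq Λ]

/-- The rotated (real) bond term of the antiferromagnet with a field on the first component:
`-S¹_xS¹_y + S²_xS²_y - S³_xS³_y - (h_x - h_y)(S¹_x - S¹_y) + ½(h_x - h_y)²` (symmetrised products),
i.e. `xyRealBond - S³S³` — the summand of [KLS1988JSP] eq. (17) in the form (16)
`-(T¹T¹ + T²T² + T³T³)`, `T² = iS²`; [DLS1978] (41b). [cite: KLS1988JSP, eqs. (16)–(17)] -/
def heisRealBond (n : ℕ) (h : Λ → ℝ) (x y : Λ) : Op Λ (n + 1) :=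
  xyRealBond n h x y - spinBond n 2 x y

/-- `heisRealBond` is symmetric in the two sites. [cite: KLS1988JSP, eq. (17)] -/
theorem heisRealBond_comm (n : ℕ) (h : Λ → ℝ) (x y : Λ) :
    heisRealBond n h x y = heisRealBond n h y x := by
  rw [heisRealBond, heisRealBond, xyRealBond_comm n h x y, spinBond_two_symm n x y]

/-- `heisRealBond` is Hermitian. [cite: KLS1988JSP, eq. (17)] -/
theorem heisRealBond_isHermitian (n : ℕ) (h : Λ → ℝ) (x y : Λ) :
    (heisRealBond n h x y).IsHermitian :=
  (xyRealBond_isHermitian n h x y).sub (spinBond_isHermitian n 2 x y)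

/-- `heisRealBond` is a real matrix ([KLS1988JSP] p. 1027: "the matrices `Tⁱ` all have only real
entries"). [cite: KLS1988JSP, eq. (16)] -/
theorem heisRealBond_transpose_eq (n : ℕ) (h : Λ → ℝ) (x y : Λ) :
    (heisRealBond n h x y)ᵀ = (heisRealBond n h x y)ᴴ :=
  transpose_eq_conjTranspose_sub (xyRealBond_transpose_eq n h x y) (spinBond_two_transpose_eq n x y)

/-- If `h_x = h_y` the rotated bond term is the zero-field one. [cite: KLS1988JSP, p. 1027] -/
theorem heisRealBond_congr (n : ℕ) {h₁ h₂ : Λ → ℝ} {x y : Λ} (hx : h₁ x = h₂ x) (hy : h₁ y = h₂ y) :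
    heisRealBond n h₁ x y = heisRealBond n h₂ x y := by
  simp only [heisRealBond, xyRealBond, hx, hy]

variable (L : ℕ) [NeZero L] (n : ℕ)

/-- The bond term of the antiferromagnetic field Hamiltonian in the ORIGINAL frame:
`𝐒_x·𝐒_y - (h_x - h_y)(S̃¹_x - S̃¹_y) + ½(h_x - h_y)²` with the staggered first component
`S̃¹_x = (-1)^x S¹_x` — the summand of the tree's `heisFieldHamiltonian_eq_edgeSum`
([KLS1988JSP] eq. (17), rotated back by (15)–(16)). [cite: KLS1988JSP, eqs. (15)–(17)] -/
def heisFieldBond (h : TorusSite d L → ℝ) (x y : TorusSite d L) : Op (TorusSite d L) (n + 1) :=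
  spinBond n 0 x y + spinBond n 1 x y + spinBond n 2 x y -
    ((h x - h y : ℝ) : ℂ) • (stagSiteSpinX L n x - stagSiteSpinX L n y) +
    (((h x - h y) ^ 2 / 2 : ℝ) : ℂ) • 1

/-- `heisFieldBond` is symmetric in the two sites. [cite: KLS1988JSP, eq. (17)] -/
theorem heisFieldBond_comm (h : TorusSite d L → ℝ) (x y : TorusSite d L) :
    heisFieldBond L n h x y = heisFieldBond L n h y x := by
  simp only [heisFieldBond, spinBond_comm n _ x y]
  congr 2
  · rw [← neg_sub (h y) (h x), Complex.ofReal_neg, neg_smul, ← smul_neg, neg_sub]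
  · rw [← neg_sub (h y) (h x), neg_sq]

/-- At zero field the bond term is `𝐒_x·𝐒_y` ([KLS1988JSP] after eq. (17): "When h = 0 this agrees
with the above Hamiltonian"). [cite: KLS1988JSP, eq. (17)] -/
theorem heisFieldBond_zero (x y : TorusSite d L) :
    heisFieldBond L n (fun _ => (0 : ℝ)) x y = spinDot n x y := by
  simp only [heisFieldBond, spinDot, Fin.sum_univ_three, sub_self, Complex.ofReal_zero, zero_smul,
    sub_zero]
  norm_num

/-- If `h_x = h_y` the bond term is the zero-field one. [cite: KLS1988JSP, eq. (17), p. 1027] -/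
theorem heisFieldBond_of_eq {h : TorusSite d L → ℝ} {x y : TorusSite d L} (hxy : h x = h y) :
    heisFieldBond L n h x y = spinDot n x y := by
  simp only [heisFieldBond, spinDot, Fin.sum_univ_three, hxy, sub_self, Complex.ofReal_zero,
    zero_smul, sub_zero]
  norm_num

/-- The field bond term is Hermitian. [cite: KLS1988JSP, eq. (17)] -/
theorem heisFieldBond_isHermitian (h : TorusSite d L → ℝ) (x y : TorusSite d L) :
    (heisFieldBond L n h x y).IsHermitian := by
  unfold heisFieldBond
  refine IsHermitian.add (IsHermitian.sub (IsHermitian.add (IsHermitian.add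
    (spinBond_isHermitian n 0 x y) (spinBond_isHermitian n 1 x y)) (spinBond_isHermitian n 2 x y))
    (IsHermitian.smul ((stagSiteSpinX_isHermitian L n x).sub (stagSiteSpinX_isHermitian L n y))
      (isSelfAdjoint_ofReal _))) (isHermitian_one.smul (isSelfAdjoint_ofReal _))

/-- **The Heisenberg antiferromagnet with bond weights** `H_w = Σ_{⟨xy⟩} w_{xy} 𝐒_x·𝐒_y` on the
torus `(ℤ/Lℤ)^d`, spin `n/2` ([KLS1988JSP] eq. (5): `H = Σ J_{xy} 𝐒_x·𝐒_y`). [cite: KLS1988JSP, eq. (5)] -/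
def heisWeightedHamiltonian (w : Sym2 (TorusSite d L) → ℝ) : Op (TorusSite d L) (n + 1) :=
  ∑ e ∈ (torusGraph d L).edgeFinset, ((w e : ℝ) : ℂ) • spinDotSym n e

/-- **The weighted field Hamiltonian of the antiferromagnet**
`H_w(h) = Σ_{⟨xy⟩} w_{xy}[𝐒_x·𝐒_y - (h_x - h_y)(S̃¹_x - S̃¹_y) + ½(h_x - h_y)²]`
([KLS1988JSP] eq. (17) with the couplings of eq. (5), original frame).
[cite: KLS1988JSP, eqs. (5), (17)] -/
def heisWeightedFieldHamiltonian (w : Sym2 (TorusSite d L) → ℝ) (h : TorusSite d L → ℝ) :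
    Op (TorusSite d L) (n + 1) :=
  ∑ e ∈ (torusGraph d L).edgeFinset,
    ((w e : ℝ) : ℂ) • Sym2.lift ⟨fun x y => heisFieldBond L n h x y,
      fun x y => heisFieldBond_comm L n h x y⟩ e

/-- **The weighted rotated field Hamiltonian** `H♭_w(h) = Σ_{⟨xy⟩} w_{xy} (xyRealBond - S³S³)(x,y)`:
[KLS1988JSP] eq. (17) after the sublattice rotation (15)–(16), with the couplings of eq. (5);
[DLS1978] (41b) with weights. [cite: KLS1988JSP, eqs. (5), (16)–(17)] -/
def heisWeightedRealFieldHamiltonian (w : Sym2 (TorusSite d L) → ℝ) (h : TorusSite d L → ℝ) :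
    Op (TorusSite d L) (n + 1) :=
  ∑ e ∈ (torusGraph d L).edgeFinset,
    ((w e : ℝ) : ℂ) • Sym2.lift ⟨fun x y => heisRealBond n h x y, fun x y => heisRealBond_comm n h x y⟩ e

/-- The weighted `S³S³` bond sum `Σ_{⟨xy⟩} w_{xy} ½(S³_xS³_y + S³_yS³_x)`. [cite: DLS1978, Thm. 6.1 (proof)] -/
def zzWeighted (w : Sym2 (TorusSite d L) → ℝ) : Op (TorusSite d L) (n + 1) :=
  ∑ e ∈ (torusGraph d L).edgeFinset,
    ((w e : ℝ) : ℂ) • Sym2.lift ⟨fun x y => spinBond n 2 x y, spinBond_two_symm n⟩ e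

/-- `H♭_w(h) = (weighted XY real field Hamiltonian) - (weighted S³S³ sum)`: the tree's
`dlsField = xyRealFieldHamiltonian - torusZZBondSum` with weights. [cite: DLS1978, Thm. 6.1] -/
theorem heisWeightedRealFieldHamiltonian_eq_sub (w : Sym2 (TorusSite d L) → ℝ)
    (h : TorusSite d L → ℝ) :
    heisWeightedRealFieldHamiltonian L n w h =
      xyWeightedRealFieldHamiltonian L n w h - zzWeighted L n w := by
  unfold heisWeightedRealFieldHamiltonian xyWeightedRealFieldHamiltonian zzWeighted
  rw [← sum_sub_distrib]
  refine sum_congr rfl fun e _ => ?_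
  rw [← smul_sub]
  congr 1
  induction e using Sym2.ind with
  | h x y => simp only [Sym2.lift_mk, heisRealBond]

/-- `H_w(0) = H_w` ([KLS1988JSP] after eq. (17)). [cite: KLS1988JSP, eq. (17)] -/
theorem heisWeightedFieldHamiltonian_zero (w : Sym2 (TorusSite d L) → ℝ) :
    heisWeightedFieldHamiltonian L n w (fun _ => 0) = heisWeightedHamiltonian L n w := by
  unfold heisWeightedFieldHamiltonian heisWeightedHamiltonian
  refine sum_congr rfl fun e _ => ?_
  congr 1
  induction e using Sym2.ind with
  | h x y => simp only [Sym2.lift_mk, heisFieldBond_zero, spinDotSym_mk]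

/-- **No bad bonds ⇒ `H_w(h) = H_w`**: if `h_x = h_y` on every bond then the field terms vanish
([KLS1988JSP] p. 1027: "(18) is equivalent to proving that E(h) attains its minimum when `h_x` is
a constant"). [cite: KLS1988JSP, p. 1027] -/
theorem heisWeightedFieldHamiltonian_eq_of_badBondCount_eq_zero (w : Sym2 (TorusSite d L) → ℝ)
    {h : TorusSite d L → ℝ} (h0 : badBondCount L h = 0) :
    heisWeightedFieldHamiltonian L n w h = heisWeightedHamiltonian L n w := by
  classical
  rw [badBondCount, Finset.card_eq_zero, Finset.filter_eq_empty_iff] at h0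
  unfold heisWeightedFieldHamiltonian heisWeightedHamiltonian
  refine sum_congr rfl fun e he => ?_
  congr 1
  have h1 := h0 he
  revert h1
  induction e using Sym2.ind with
  | h x y =>
    intro h1
    rw [not_not, Sym2.map_mk, Sym2.mk_isDiag_iff] at h1
    simp only [Sym2.lift_mk, heisFieldBond_of_eq L n h1, spinDotSym_mk]

/-- `H♭_w(h)` is Hermitian (real symmetric bond terms). [cite: KLS1988JSP, eqs. (16)–(17)] -/
theorem heisWeightedRealFieldHamiltonian_isHermitian (w : Sym2 (TorusSite d L) → ℝ)
    (h : TorusSite d L → ℝ) : (heisWeightedRealFieldHamiltonian L n w h).IsHermitian := by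
  unfold heisWeightedRealFieldHamiltonian
  rw [IsHermitian, conjTranspose_sum]
  refine sum_congr rfl fun e _ => ?_
  rw [conjTranspose_smul, (isSelfAdjoint_ofReal _).star_eq]
  congr 1
  induction e using Sym2.ind with
  | h x y => exact (heisRealBond_isHermitian n h x y).eq

/-- `H_w(h)` is Hermitian. [cite: KLS1988JSP, eq. (17)] -/
theorem heisWeightedFieldHamiltonian_isHermitian (w : Sym2 (TorusSite d L) → ℝ)
    (h : TorusSite d L → ℝ) : (heisWeightedFieldHamiltonian L n w h).IsHermitian := by
  unfold heisWeightedFieldHamiltonian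
  rw [IsHermitian, conjTranspose_sum]
  refine sum_congr rfl fun e _ => ?_
  rw [conjTranspose_smul, (isSelfAdjoint_ofReal _).star_eq]
  congr 1
  induction e using Sym2.ind with
  | h x y => exact (heisFieldBond_isHermitian L n h x y).eq

/-- `H_w` is Hermitian. [cite: KLS1988JSP, eq. (5)] -/
theorem heisWeightedHamiltonian_isHermitian (w : Sym2 (TorusSite d L) → ℝ) :
    (heisWeightedHamiltonian L n w).IsHermitian := by
  rw [← heisWeightedFieldHamiltonian_zero]
  exact heisWeightedFieldHamiltonian_isHermitian L n w _

end Defs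

/-! ### The weighted half-space operators and the Kronecker form -/

section Halves

variable (L : ℕ) [NeZero L] (j : Fin d) (a : ZMod L) (hL : Even L) (n : ℕ)

/-- The weighted `S³S³` bond sum of the left half, `Z_w = Σ_{left bonds} w_{xy} ½(S³S³ + S³S³)`, as
an operator on the state space of the left half. [cite: DLS1978, Thm. 6.1 (proof)] -/
def zzWeightedLeft (w : Sym2 (TorusSite d L) → ℝ) : Op (torusLeftHalf L j a) (n + 1) :=
  ∑ e ∈ torusLeftEdges L j a, ((w e : ℝ) : ℂ) •
    Sym2.lift ⟨fun x y => spinBond n 2 (torusToLeft L j a hL x) (torusToLeft L j a hL y),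
      fun _ _ => spinBond_two_symm n _ _⟩ e

/-- The weighted third crossing operators `√(w_{x,θx}) · T³_x` (left endpoints of crossing bonds),
on the left half. [cite: DLS1978, Thm. 6.1 (proof)] [cite: KLS1988JSP, eqs. (20)–(21)] -/
def zzWeightedCrossOp (w : Sym2 (TorusSite d L) → ℝ) (x : torusCrossSites L j a) :
    Op (torusLeftHalf L j a) (n + 1) :=
  ((Real.sqrt (w s((x : TorusSite d L), Torus.reflectBetweenSites j a x)) : ℝ) : ℂ) •
    torusZZCrossOp L j a hL n x

/-- **The weighted left Hamiltonian of the antiferromagnet** `A_w(h) - Z_w`: the XY weighted left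
Hamiltonian of `AnisotropicXYGaussianDomination` minus the weighted left `S³S³` sum
([KLS1988JSP] eq. (21), `H^L`, with the couplings of eq. (5); [DLS1978] Thm. 6.1).
[cite: KLS1988JSP, eqs. (5), (21)] -/
def heisWeightedLeftHamiltonian (w : Sym2 (TorusSite d L) → ℝ) (h : TorusSite d L → ℝ) :
    Op (torusLeftHalf L j a) (n + 1) :=
  xyWeightedLeftHamiltonian L j a hL n w h - zzWeightedLeft L j a hL n w

/-- **The weighted crossing operators of the antiferromagnet**: the two XY ones (`√w(T¹ - h)`,
`√w T²`) and the third one `√w T³` per crossing bond ([KLS1988JSP] eqs. (20)–(21): three real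
cross terms per crossing bond). [cite: KLS1988JSP, eqs. (20)–(21)] -/
def heisWeightedCrossOp (w : Sym2 (TorusSite d L) → ℝ) (h : TorusSite d L → ℝ) :
    torusCrossSites L j a × Bool ⊕ torusCrossSites L j a → Op (torusLeftHalf L j a) (n + 1) :=
  Sum.elim (xyWeightedCrossOp L j a hL n w h) (zzWeightedCrossOp L j a hL n w)

variable {L j a hL n}

/-- `Z_w` is Hermitian. [cite: DLS1978, Lemma 6.1] -/
theorem zzWeightedLeft_isHermitian (w : Sym2 (TorusSite d L) → ℝ) :
    (zzWeightedLeft L j a hL n w).IsHermitian := by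
  rw [zzWeightedLeft, IsHermitian, conjTranspose_sum]
  refine sum_congr rfl fun e _ => ?_
  rw [conjTranspose_smul, (isSelfAdjoint_ofReal _).star_eq]
  congr 1
  induction e using Sym2.ind with
  | h x y =>
    simp only [Sym2.lift_mk]
    exact (spinBond_isHermitian n 2 _ _).eq

/-- `Z_w` is a real matrix ([KLS1988JSP] p. 1028: real matrix elements in the `S³` basis). [cite: DLS1978, Lemma 6.1] [cite: KLS1988JSP, p. 1028] -/
theorem zzWeightedLeft_transpose_eq (w : Sym2 (TorusSite d L) → ℝ) :
    (zzWeightedLeft L j a hL n w)ᵀ = (zzWeightedLeft L j a hL n w)ᴴ := by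
  rw [zzWeightedLeft, transpose_sum, conjTranspose_sum]
  refine sum_congr rfl fun e _ => ?_
  refine transpose_eq_conjTranspose_ofReal_smul ?_ _
  induction e using Sym2.ind with
  | h x y =>
    simp only [Sym2.lift_mk]
    exact spinBond_two_transpose_eq n _ _

/-- The weighted third crossing operators are real matrices. [cite: DLS1978, Lemma 6.1] [cite: KLS1988JSP, p. 1028] -/
theorem zzWeightedCrossOp_transpose_eq (w : Sym2 (TorusSite d L) → ℝ) (x : torusCrossSites L j a) :
    (zzWeightedCrossOp L j a hL n w x)ᵀ = (zzWeightedCrossOp L j a hL n w x)ᴴ :=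
  transpose_eq_conjTranspose_ofReal_smul (torusZZCrossOp_transpose_eq L j a hL n x) _

/-- `A_w(h) - Z_w` is Hermitian. [cite: KLS1988JSP, eq. (21)] -/
theorem heisWeightedLeftHamiltonian_isHermitian (w : Sym2 (TorusSite d L) → ℝ)
    (h : TorusSite d L → ℝ) : (heisWeightedLeftHamiltonian L j a hL n w h).IsHermitian :=
  (xyWeightedLeftHamiltonian_isHermitian w h).sub (zzWeightedLeft_isHermitian w)

/-- `A_w(h) - Z_w` is a real matrix. [cite: KLS1988JSP, p. 1028] -/
theorem heisWeightedLeftHamiltonian_transpose_eq (w : Sym2 (TorusSite d L) → ℝ)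
    (h : TorusSite d L → ℝ) :
    (heisWeightedLeftHamiltonian L j a hL n w h)ᵀ = (heisWeightedLeftHamiltonian L j a hL n w h)ᴴ :=
  transpose_eq_conjTranspose_sub (xyWeightedLeftHamiltonian_transpose_eq w h)
    (zzWeightedLeft_transpose_eq w)

/-- `A_w(h) - Z_w` is complex-symmetric (real and Hermitian). [cite: KLS1988JSP, eq. (21), p. 1028] -/
theorem heisWeightedLeftHamiltonian_transpose (w : Sym2 (TorusSite d L) → ℝ)
    (h : TorusSite d L → ℝ) :
    (heisWeightedLeftHamiltonian L j a hL n w h)ᵀ = heisWeightedLeftHamiltonian L j a hL n w h := by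
  rw [heisWeightedLeftHamiltonian_transpose_eq, (heisWeightedLeftHamiltonian_isHermitian w h).eq]

/-- All weighted crossing operators of the antiferromagnet are real matrices.
[cite: KLS1988JSP, p. 1028] [cite: DLS1978, Lemma 6.1] -/
theorem heisWeightedCrossOp_transpose_eq (w : Sym2 (TorusSite d L) → ℝ) (h : TorusSite d L → ℝ)
    (i : torusCrossSites L j a × Bool ⊕ torusCrossSites L j a) :
    (heisWeightedCrossOp L j a hL n w h i)ᵀ = (heisWeightedCrossOp L j a hL n w h i)ᴴ := by
  rcases i with i | x
  · exact xyWeightedCrossOp_transpose_eq w h i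
  · exact zzWeightedCrossOp_transpose_eq w x

/-- `A_w(h) - Z_w` depends on `h` only through `h` on the left half. [cite: KLS1988JSP, eq. (21), p. 1028] -/
theorem heisWeightedLeftHamiltonian_congr (w : Sym2 (TorusSite d L) → ℝ) {h₁ h₂ : TorusSite d L → ℝ}
    (hh : ∀ x ∈ torusLeftHalf L j a, h₁ x = h₂ x) :
    heisWeightedLeftHamiltonian L j a hL n w h₁ = heisWeightedLeftHamiltonian L j a hL n w h₂ := by
  rw [heisWeightedLeftHamiltonian, heisWeightedLeftHamiltonian, xyWeightedLeftHamiltonian_congr w hh]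

/-- The weighted crossing operators depend on `h` only through `h` on the left half.
[cite: KLS1988JSP, eq. (21), p. 1028] -/
theorem heisWeightedCrossOp_congr (w : Sym2 (TorusSite d L) → ℝ) {h₁ h₂ : TorusSite d L → ℝ}
    (hh : ∀ x ∈ torusLeftHalf L j a, h₁ x = h₂ x) :
    heisWeightedCrossOp L j a hL n w h₁ = heisWeightedCrossOp L j a hL n w h₂ := by
  rw [heisWeightedCrossOp, heisWeightedCrossOp, xyWeightedCrossOp_congr w hh]

variable (L j a hL n)

/-- **The Kronecker form of the weighted `S³S³` bond sum**: for a nonnegative weight invariant under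
the reflection `θ` in the chosen planes,
`Σ_{⟨xy⟩} w S³S³ = Z_w ⊗ 1 + 1 ⊗ Z_w + Σ_{x crossing} (√w T³_x) ⊗ (√w T³_x)`.
[cite: DLS1978, Lemma 6.1, Thm. 6.1] [cite: KLS1988JSP, eqs. (5), (20)–(21)] -/
theorem zzWeighted_eq_embed {w : Sym2 (TorusSite d L) → ℝ} (hw0 : ∀ e, 0 ≤ w e)
    (hwθ : ∀ e, w (e.map (Torus.reflectBetweenSites j a)) = w e) :
    zzWeighted L n w =
      torusLeftEmbed L j a hL (zzWeightedLeft L j a hL n w) +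
        torusRightEmbed L j a hL (zzWeightedLeft L j a hL n w) +
        ∑ x : torusCrossSites L j a,
          torusLeftEmbed L j a hL (zzWeightedCrossOp L j a hL n w x) *
            torusRightEmbed L j a hL (zzWeightedCrossOp L j a hL n w x) := by
  rw [zzWeighted, sum_edgeFinset_split L j a hL]
  set T : Sym2 (TorusSite d L) → Op (torusLeftHalf L j a) (n + 1) := fun e =>
    Sym2.lift ⟨fun x y => spinBond n 2 (torusToLeft L j a hL x) (torusToLeft L j a hL y),
      fun _ _ => spinBond_two_symm n _ _⟩ e with hT
  -- (1) left bonds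
  have h1 : ∑ e ∈ torusLeftEdges L j a, ((w e : ℝ) : ℂ) •
      Sym2.lift ⟨fun x y => spinBond n 2 x y, spinBond_two_symm n⟩ e =
        torusLeftEmbed L j a hL (∑ e ∈ torusLeftEdges L j a, ((w e : ℝ) : ℂ) • T e) := by
    rw [map_sum]
    refine sum_congr rfl fun e he => ?_
    rw [map_smul]
    congr 1
    obtain ⟨-, hl⟩ := mem_filter.1 he
    revert hl
    refine Sym2.ind (fun x y => ?_) e
    intro hl
    simp only [hT, Sym2.lift_mk]
    exact spinBond_two_eq_torusLeftEmbed (hl x (Sym2.mem_mk_left x y))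
      (hl y (Sym2.mem_mk_right x y))
  -- (2) right bonds
  have h2 : ∑ e ∈ ((torusGraph d L).edgeFinset.filter fun e => ∀ x ∈ e, x ∉ torusLeftHalf L j a),
      ((w e : ℝ) : ℂ) • Sym2.lift ⟨fun x y => spinBond n 2 x y, spinBond_two_symm n⟩ e =
        torusRightEmbed L j a hL (∑ e ∈ torusLeftEdges L j a, ((w e : ℝ) : ℂ) • T e) := by
    rw [← sum_rightEdges_eq_sum_leftEdges L j a hL (fun e => ((w e : ℝ) : ℂ) • T e), map_sum]
    · refine sum_congr rfl fun e he => ?_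
      rw [map_smul]
      congr 1
      obtain ⟨-, hr⟩ := mem_filter.1 he
      revert hr
      refine Sym2.ind (fun x y => ?_) e
      intro hr
      simp only [hT, Sym2.lift_mk]
      exact spinBond_two_eq_torusRightEmbed (hr x (Sym2.mem_mk_left x y))
        (hr y (Sym2.mem_mk_right x y))
    · intro e
      rw [hwθ e]
      congr 1
      refine Sym2.ind (fun x y => ?_) e
      simp only [hT, Sym2.map_mk, Sym2.lift_mk, torusToLeft_reflectBetweenSites]
  -- (3) crossing bonds
  have h3 : ∑ x ∈ torusCrossSites L j a, ((w s(x, Torus.reflectBetweenSites j a x) : ℝ) : ℂ) •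
      Sym2.lift ⟨fun x y => spinBond n 2 x y, spinBond_two_symm n⟩
        s(x, Torus.reflectBetweenSites j a x) =
      ∑ x : torusCrossSites L j a,
          torusLeftEmbed L j a hL (zzWeightedCrossOp L j a hL n w x) *
            torusRightEmbed L j a hL (zzWeightedCrossOp L j a hL n w x) := by
    rw [← Finset.sum_coe_sort (torusCrossSites L j a)]
    refine sum_congr rfl fun x _ => ?_
    have hsq : ((Real.sqrt (w s((x : TorusSite d L), Torus.reflectBetweenSites j a x)) : ℝ) : ℂ) *
        ((Real.sqrt (w s((x : TorusSite d L), Torus.reflectBetweenSites j a x)) : ℝ) : ℂ) =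
        ((w s((x : TorusSite d L), Torus.reflectBetweenSites j a x) : ℝ) : ℂ) := by
      rw [← Complex.ofReal_mul, Real.mul_self_sqrt (hw0 _)]
    simp only [Sym2.lift_mk]
    rw [spinBond_two_cross (hL := hL) x]
    simp only [zzWeightedCrossOp, map_smul, smul_mul_smul_comm, hsq]
  rw [h1, h2, h3, zzWeightedLeft]

/-- **The Kronecker form of the weighted rotated field Hamiltonian of the antiferromagnet**
([KLS1988JSP] eq. (21) for the couplings of eq. (5); [DLS1978] Thm. 6.1 with Lemma 6.1): for a
nonnegative weight invariant under the reflection `θ` in the chosen planes,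
`H♭_w(g) = (A_w(g) - Z_w) ⊗ 1 + 1 ⊗ (A_w(g∘θ) - Z_w) - Σᵢ Mᵢ ⊗ Nᵢ`, the sum running over the
three real crossing operators of every crossing bond. [cite: KLS1988JSP, eqs. (5), (20)–(21)] -/
theorem heisWeightedRealFieldHamiltonian_eq_submatrix {w : Sym2 (TorusSite d L) → ℝ}
    (hw0 : ∀ e, 0 ≤ w e)
    (hwθ : ∀ e, w (e.map (Torus.reflectBetweenSites j a)) = w e) (g : TorusSite d L → ℝ) :
    heisWeightedRealFieldHamiltonian L n w g =
      (heisWeightedLeftHamiltonian L j a hL n w g ⊗ₖ (1 : Op (torusLeftHalf L j a) (n + 1)) +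
          (1 : Op (torusLeftHalf L j a) (n + 1)) ⊗ₖ
            heisWeightedLeftHamiltonian L j a hL n w (fun y => g (Torus.reflectBetweenSites j a y)) -
          ∑ i, heisWeightedCrossOp L j a hL n w g i ⊗ₖ
            heisWeightedCrossOp L j a hL n w (fun y => g (Torus.reflectBetweenSites j a y)) i).submatrix
        (torusSplit L j a hL) (torusSplit L j a hL) := by
  rw [submatrix_kroneckerForm, heisWeightedRealFieldHamiltonian_eq_sub,
    xyWeightedRealFieldHamiltonian_eq_submatrix L j a hL n hw0 hwθ g, submatrix_kroneckerForm,
    zzWeighted_eq_embed L j a hL n hw0 hwθ, Fintype.sum_sum_type]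
  simp only [heisWeightedCrossOp, heisWeightedLeftHamiltonian, Sum.elim_inl, Sum.elim_inr, map_sub]
  abel

end Halves

/-! ### The sublattice rotation, bond by bond -/

section Rotation

variable (L : ℕ) [NeZero L]

/-- **The sublattice rotation, bond by bond** ([KLS1988JSP] eqs. (15)–(16); [DLS1978] §2): on the
even torus of side `L ≥ 3` and for every spin `n/2`, the rotation by `π` about the `2`-axis on
the odd sublattice is ONE unitary `W` with `W τ⁰_h(x,y) Wᴴ = τ_h(x,y)` for every bond `{x,y}` of
the torus graph and every real field `h` (`τ⁰_h = heisFieldBond`, `τ_h = heisRealBond`):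
`S¹ ↦ ∓S¹`, `S³ ↦ ∓S³`, `S² ↦ S²`, the staggered `S̃¹ ↦ S¹` — the bond-wise content of the tree's
`groundEnergy_heisFieldHamiltonian_eq`, so that every WEIGHTED bond sum is conjugated into its
real form. [cite: KLS1988JSP, eqs. (15)–(17)] [cite: DLS1978, §2] -/
theorem exists_unitary_conj_heisFieldBond (hL : Even L) (hL3 : 3 ≤ L) (n : ℕ) :
    ∃ W ∈ Matrix.unitaryGroup (TensorIndex (TorusSite d L) (n + 1)) ℂ,
      ∀ (h : TorusSite d L → ℝ), ∀ e ∈ (torusGraph d L).edgeFinset,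
        W * Sym2.lift ⟨fun x y => heisFieldBond L n h x y, fun x y => heisFieldBond_comm L n h x y⟩ e *
            Wᴴ =
          Sym2.lift ⟨fun x y => heisRealBond n h x y, fun x y => heisRealBond_comm n h x y⟩ e := by
  obtain ⟨k, rfl⟩ : ∃ k, L = 2 * k := ⟨L / 2, by obtain ⟨k, hk⟩ := hL; omega⟩
  set E := (torusGraph d (2 * k)).edgeFinset with hE
  -- the single-site rotation `R₂ = V²` (`π` about the `2`-axis): `Sˣ ↦ -Sˣ`, `Sʸ ↦ Sʸ`, `Sᶻ ↦ -Sᶻ`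
  obtain ⟨V, hV, hV', hVz, hVx, hVy⟩ := exists_unitary_conj_spinZ_eq_spinX n
  set R := V * V with hR
  have hRR : R * Rᴴ = 1 := by
    rw [hR, conjTranspose_mul, Matrix.mul_assoc, ← Matrix.mul_assoc V Vᴴ, hV, Matrix.one_mul, hV]
  have hRR' : Rᴴ * R = 1 := by
    rw [hR, conjTranspose_mul, Matrix.mul_assoc, ← Matrix.mul_assoc Vᴴ V, hV', Matrix.one_mul, hV']
  have hRz : R * SpinOperators.spinZ n * Rᴴ = -SpinOperators.spinZ n := by
    rw [hR, conjTranspose_mul, show V * V * SpinOperators.spinZ n * (Vᴴ * Vᴴ) =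
      V * (V * SpinOperators.spinZ n * Vᴴ) * Vᴴ by simp only [Matrix.mul_assoc], hVz, hVx]
  have hRy : R * spinY n * Rᴴ = spinY n := by
    rw [hR, conjTranspose_mul, show V * V * spinY n * (Vᴴ * Vᴴ) =
      V * (V * spinY n * Vᴴ) * Vᴴ by simp only [Matrix.mul_assoc], hVy, hVy]
  have hRx : R * spinX n * Rᴴ = -spinX n := by
    rw [hR, conjTranspose_mul, show V * V * spinX n * (Vᴴ * Vᴴ) =
      V * (V * spinX n * Vᴴ) * Vᴴ by simp only [Matrix.mul_assoc], hVx, Matrix.mul_neg,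
      Matrix.neg_mul, hVz]
  -- the product unitary on the odd sublattice
  set ε : TorusSite d (2 * k) → ZMod 2 := fun x =>
    ∑ j, ZMod.castHom (dvd_mul_right 2 k) (ZMod 2) (x j) with hε
  set u : TorusSite d (2 * k) → Matrix (Fin (n + 1)) (Fin (n + 1)) ℂ :=
    fun z => if ε z = 0 then 1 else R with hu
  have hua : ∀ z, u z * (u z)ᴴ = 1 := by
    intro z; simp only [hu]; split_ifs
    · rw [conjTranspose_one, Matrix.mul_one]
    · exact hRR
  have hub : ∀ z, (u z)ᴴ * u z = 1 := by
    intro z; simp only [hu]; split_ifs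
    · rw [conjTranspose_one, Matrix.mul_one]
    · exact hRR'
  set sgn : TorusSite d (2 * k) → ℂ := fun z => if ε z = 0 then 1 else -1 with hsgn
  have hsgnN : ∀ z, (neelSign z : ℂ) = sgn z := fun z => neelSign_eq_ite k z
  have hsgn2 : ∀ z, sgn z * sgn z = 1 := by
    intro z; simp only [hsgn]; split_ifs <;> norm_num
  have hux : ∀ z, u z * spinX n * (u z)ᴴ = sgn z • spinX n := by
    intro z; simp only [hu, hsgn]; split_ifs
    · rw [conjTranspose_one, Matrix.mul_one, Matrix.one_mul, one_smul]
    · rw [hRx, neg_one_smul]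
  have huy : ∀ z, u z * spinY n * (u z)ᴴ = spinY n := by
    intro z; simp only [hu]; split_ifs
    · rw [conjTranspose_one, Matrix.mul_one, Matrix.one_mul]
    · exact hRy
  have huz : ∀ z, u z * SpinOperators.spinZ n * (u z)ᴴ = sgn z • SpinOperators.spinZ n := by
    intro z; simp only [hu, hsgn]; split_ifs
    · rw [conjTranspose_one, Matrix.mul_one, Matrix.one_mul, one_smul]
    · rw [hRz, neg_one_smul]
  have hedge : ∀ e ∈ E, ∀ x y, e = s(x, y) → sgn x * sgn y = -1 := by
    intro e he x y hexy
    subst hexy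
    rw [hE, SimpleGraph.mem_edgeFinset, SimpleGraph.mem_edgeSet, torusGraph_adj_iff] at he
    have h01 : ∀ t : ZMod 2, t = 0 ∨ t = 1 := by decide
    have key : ∀ x' : TorusSite d (2 * k), ∀ i, sgn x' * sgn (x' + Pi.single i 1) = -1 := by
      intro x' i
      have hpar : ε (x' + Pi.single i 1) = ε x' + 1 := torusParity_add_single k x' i
      simp only [hsgn, hpar]
      rcases h01 (ε x') with h0 | h1
      · rw [if_pos h0, if_neg (by rw [h0]; decide), one_mul]
      · rw [if_neg (by rw [h1]; decide), if_pos (by rw [h1]; decide), mul_one]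
    obtain ⟨-, ⟨i, rfl⟩ | ⟨i, rfl⟩⟩ := he
    · exact key x i
    · rw [mul_comm]; exact key y i
  set W := productOp u with hW
  -- conjugation of the atoms
  have hWs : ∀ x : TorusSite d (2 * k), W * stagSiteSpinX (2 * k) n x * Wᴴ = siteSpin n x 0 := by
    intro x
    rw [stagSiteSpinX, Matrix.mul_smul, Matrix.smul_mul, hW, productOp_conj_siteSpin hua, spinVec_zero,
      hux, onSite_smul', smul_smul, hsgnN, hsgn2, one_smul]
    rfl
  have hb0 : ∀ x y : TorusSite d (2 * k), sgn x * sgn y = -1 →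
      W * spinBond n 0 x y * Wᴴ = -spinBond n 0 x y := by
    intro x y hxy
    rw [hW, productOp_conj_spinBond hua hub, spinVec_zero, hux, hux, onSite_smul', onSite_smul',
      smul_mul_smul_comm, smul_mul_smul_comm, mul_comm (sgn y) (sgn x), hxy, spinBond]
    simp only [neg_smul, one_smul]
    rw [← neg_add, smul_neg]
    rfl
  have hb1 : ∀ x y : TorusSite d (2 * k), W * spinBond n 1 x y * Wᴴ = spinBond n 1 x y := by
    intro x y
    rw [hW, productOp_conj_spinBond hua hub, spinVec_one, huy, huy, spinBond]
    rfl
  have hb2 : ∀ x y : TorusSite d (2 * k), sgn x * sgn y = -1 →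
      W * spinBond n 2 x y * Wᴴ = -spinBond n 2 x y := by
    intro x y hxy
    rw [hW, productOp_conj_spinBond hua hub, spinVec_two, huz, huz, onSite_smul', onSite_smul',
      smul_mul_smul_comm, smul_mul_smul_comm, mul_comm (sgn y) (sgn x), hxy, spinBond]
    simp only [neg_smul, one_smul]
    rw [← neg_add, smul_neg]
    rfl
  have hW1 : W * (1 : Op (TorusSite d (2 * k)) (n + 1)) * Wᴴ = 1 := by
    rw [Matrix.mul_one, hW, productOp_mul_conjTranspose hua]
  refine ⟨W, Matrix.mem_unitaryGroup_iff.2 (by rw [hW]; exact productOp_mul_conjTranspose hua),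
    fun h e he => ?_⟩
  induction e using Sym2.ind with
  | h x y =>
    have hs := hedge _ he x y rfl
    simp only [Sym2.lift_mk, heisRealBond, xyRealBond, heisFieldBond, Matrix.mul_add, Matrix.add_mul,
      Matrix.mul_sub, Matrix.sub_mul, Matrix.mul_smul, Matrix.smul_mul, hb0 x y hs, hb1,
      hb2 x y hs, hW1, hWs]
    abel

/-- `W H_w(h) Wᴴ = H♭_w(h)` for the unitary of `exists_unitary_conj_heisFieldBond`: the weighted
field Hamiltonian is unitarily equivalent to its real form. [cite: KLS1988JSP, eqs. (15)–(17)] -/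
theorem exists_unitary_conj_heisWeightedFieldHamiltonian (hL : Even L) (hL3 : 3 ≤ L) (n : ℕ) :
    ∃ W ∈ Matrix.unitaryGroup (TensorIndex (TorusSite d L) (n + 1)) ℂ,
      ∀ (w : Sym2 (TorusSite d L) → ℝ) (h : TorusSite d L → ℝ),
        W * heisWeightedFieldHamiltonian L n w h * Wᴴ = heisWeightedRealFieldHamiltonian L n w h := by
  obtain ⟨W, hWu, hW⟩ := exists_unitary_conj_heisFieldBond (d := d) L hL hL3 n
  refine ⟨W, hWu, fun w h => ?_⟩
  rw [heisWeightedFieldHamiltonian, heisWeightedRealFieldHamiltonian, Finset.mul_sum, Finset.sum_mul]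
  refine sum_congr rfl fun e he => ?_
  rw [Matrix.mul_smul, Matrix.smul_mul, hW h e he]

/-- `E₀(H_w(h)) = E₀(H♭_w(h))` (even side `L ≥ 3`). [cite: KLS1988JSP, eqs. (15)–(17)] -/
theorem groundEnergy_heisWeightedFieldHamiltonian_eq (hL : Even L) (hL3 : 3 ≤ L) (n : ℕ)
    (w : Sym2 (TorusSite d L) → ℝ) (h : TorusSite d L → ℝ) :
    (heisWeightedFieldHamiltonian L n w h).groundEnergy =
      (heisWeightedRealFieldHamiltonian L n w h).groundEnergy := by
  obtain ⟨W, hWu, hW⟩ := exists_unitary_conj_heisWeightedFieldHamiltonian (d := d) L hL hL3 n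
  rw [← hW w h, Matrix.groundEnergy_unitary_conj hWu]

/-- `Z_β(H_w(h)) = Z_β(H♭_w(h))` (even side `L ≥ 3`). [cite: DLS1978, §2 and Thm. 4.2] -/
theorem partitionFn_heisWeightedFieldHamiltonian_eq (hL : Even L) (hL3 : 3 ≤ L) (n : ℕ) (β : ℝ)
    (w : Sym2 (TorusSite d L) → ℝ) (h : TorusSite d L → ℝ) :
    partitionFn β (heisWeightedFieldHamiltonian L n w h) =
      partitionFn β (heisWeightedRealFieldHamiltonian L n w h) := by
  obtain ⟨W, hWu, hW⟩ := exists_unitary_conj_heisWeightedFieldHamiltonian (d := d) L hL hL3 n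
  have hWu' : W ∈ unitary (Matrix (TensorIndex (TorusSite d L) (n + 1))
      (TensorIndex (TorusSite d L) (n + 1)) ℂ) := hWu
  rw [← hW w h, ← star_eq_conjTranspose, partitionFn_unitary_conj hWu']

end Rotation

/-! ### The reflection inequalities along one pair of planes -/

section Reflection

variable (L : ℕ) [NeZero L] (j : Fin d) (a : ZMod L) (n : ℕ)

/-- **The reflection inequality for the ground-state energy of the antiferromagnet, weighted
couplings** ([KLS1988JSP], the display after eq. (25), for the couplings of eq. (5)): for a
nonnegative weight invariant under the reflection in the chosen planes,
`½E_w(h^L) + ½E_w(h^R) ≤ E_w(h)`. [cite: KLS1988JSP, eqs. (5), (20)–(25)] -/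
theorem heis_groundEnergy_reflect_le_weighted (hL : Even L) (hL3 : 3 ≤ L)
    {w : Sym2 (TorusSite d L) → ℝ} (hw0 : ∀ e, 0 ≤ w e)
    (hwθ : ∀ e, w (e.map (Torus.reflectBetweenSites j a)) = w e) (h : TorusSite d L → ℝ) :
    ((heisWeightedFieldHamiltonian L n w (reflectFieldLeft L j a h)).groundEnergy +
        (heisWeightedFieldHamiltonian L n w (reflectFieldRight L j a h)).groundEnergy) / 2 ≤
      (heisWeightedFieldHamiltonian L n w h).groundEnergy := by
  rw [groundEnergy_heisWeightedFieldHamiltonian_eq L hL hL3,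
    groundEnergy_heisWeightedFieldHamiltonian_eq L hL hL3,
    groundEnergy_heisWeightedFieldHamiltonian_eq L hL hL3]
  -- abbreviations
  set A := heisWeightedLeftHamiltonian L j a hL n w h with hA
  set B := heisWeightedLeftHamiltonian L j a hL n w (fun y => h (Torus.reflectBetweenSites j a y))
    with hB
  set M := heisWeightedCrossOp L j a hL n w h with hM
  set N := heisWeightedCrossOp L j a hL n w (fun y => h (Torus.reflectBetweenSites j a y)) with hN
  set e := torusSplit (q := n + 1) L j a hL with he
  -- the three Kronecker forms
  have hK : heisWeightedRealFieldHamiltonian L n w h =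
      (A ⊗ₖ 1 + 1 ⊗ₖ B - ∑ i, M i ⊗ₖ N i).submatrix e e :=
    heisWeightedRealFieldHamiltonian_eq_submatrix L j a hL n hw0 hwθ h
  have hKL : heisWeightedRealFieldHamiltonian L n w (reflectFieldLeft L j a h) =
      (A ⊗ₖ 1 + 1 ⊗ₖ A - ∑ i, M i ⊗ₖ M i).submatrix e e := by
    rw [heisWeightedRealFieldHamiltonian_eq_submatrix L j a hL n hw0 hwθ,
      heisWeightedLeftHamiltonian_congr w (fun x hx => reflectFieldLeft_of_mem L j a h hx),
      heisWeightedLeftHamiltonian_congr w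
        (fun x hx => reflectFieldLeft_reflectBetweenSites_of_mem L j a hL h hx),
      heisWeightedCrossOp_congr w (fun x hx => reflectFieldLeft_of_mem L j a h hx),
      heisWeightedCrossOp_congr w
        (fun x hx => reflectFieldLeft_reflectBetweenSites_of_mem L j a hL h hx)]
  have hKR : heisWeightedRealFieldHamiltonian L n w (reflectFieldRight L j a h) =
      (B ⊗ₖ 1 + 1 ⊗ₖ B - ∑ i, N i ⊗ₖ N i).submatrix e e := by
    rw [heisWeightedRealFieldHamiltonian_eq_submatrix L j a hL n hw0 hwθ,
      heisWeightedLeftHamiltonian_congr w (fun x hx => reflectFieldRight_of_mem L j a h hx),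
      heisWeightedLeftHamiltonian_congr w
        (h₁ := fun y => reflectFieldRight L j a h (Torus.reflectBetweenSites j a y))
        (fun x hx => reflectFieldRight_reflectBetweenSites_of_mem L j a hL h hx),
      heisWeightedCrossOp_congr w (fun x hx => reflectFieldRight_of_mem L j a h hx),
      heisWeightedCrossOp_congr w
        (h₁ := fun y => reflectFieldRight L j a h (Torus.reflectBetweenSites j a y))
        (fun x hx => reflectFieldRight_reflectBetweenSites_of_mem L j a hL h hx)]
  -- Hermiticity of the three forms
  have herm : ∀ (f : TorusSite d L → ℝ) (K : Matrix _ _ ℂ),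
      heisWeightedRealFieldHamiltonian L n w f = K.submatrix e e → K.IsHermitian := by
    intro f K hf
    have : K = (heisWeightedRealFieldHamiltonian L n w f).submatrix e.symm e.symm := by
      rw [hf, submatrix_submatrix, Equiv.self_comp_symm, submatrix_id_id]
    rw [this]
    exact (heisWeightedRealFieldHamiltonian_isHermitian L n w f).submatrix _
  haveI : Nonempty ((torusLeftHalf L j a → Fin (n + 1)) × (torusLeftHalf L j a → Fin (n + 1))) :=
    ⟨(fun _ => 0, fun _ => 0)⟩
  have hRP := Matrix.kls_groundEnergy_reflection A B M N
    (heisWeightedLeftHamiltonian_transpose w h) (heisWeightedLeftHamiltonian_transpose w _)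
    (fun i => heisWeightedCrossOp_transpose_eq w h i) (fun i => heisWeightedCrossOp_transpose_eq w _ i)
    (herm _ _ hK) (herm _ _ hKL) (herm _ _ hKR)
  rw [hK, hKL, hKR, Matrix.groundEnergy_submatrix_equiv (herm _ _ hK),
    Matrix.groundEnergy_submatrix_equiv (herm _ _ hKL),
    Matrix.groundEnergy_submatrix_equiv (herm _ _ hKR)]
  exact hRP

/-- **The reflection inequality for the partition function of the antiferromagnet, weighted
couplings** ([DLS1978] Lemma 4.1 as in the proof of Thm. 4.2 / Thm. 6.1): for a nonnegative weight
invariant under the reflection in the chosen planes and every `β > 0`,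
`Z_w(h)² ≤ Z_w(h^L) Z_w(h^R)`, `Z_w(f) = Tr exp(-βH_w(f))`.
[cite: DLS1978, Lemma 4.1, Thm. 4.2, Thm. 6.1] [cite: KLS1988JSP, eq. (5)] -/
theorem heis_partitionFn_weighted_sq_le (hL : Even L) (hL3 : 3 ≤ L) {β : ℝ} (hβ : 0 < β)
    {w : Sym2 (TorusSite d L) → ℝ} (hw0 : ∀ e, 0 ≤ w e)
    (hwθ : ∀ e, w (e.map (Torus.reflectBetweenSites j a)) = w e) (h : TorusSite d L → ℝ) :
    (partitionFn β (heisWeightedFieldHamiltonian L n w h)).re ^ 2 ≤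
      (partitionFn β (heisWeightedFieldHamiltonian L n w (reflectFieldLeft L j a h))).re *
        (partitionFn β (heisWeightedFieldHamiltonian L n w (reflectFieldRight L j a h))).re := by
  -- positivity of the three partition functions
  have hZpos : ∀ f : TorusSite d L → ℝ,
      0 < (partitionFn β (heisWeightedFieldHamiltonian L n w f)).re :=
    fun f => (partitionFn_re_pos β (heisWeightedFieldHamiltonian_isHermitian L n w f)).1
  have hx0 := hZpos h
  have hy0 := hZpos (reflectFieldLeft L j a h)
  have hz0 := hZpos (reflectFieldRight L j a h)
  -- abbreviations
  set A := heisWeightedLeftHamiltonian L j a hL n w h with hA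
  set B := heisWeightedLeftHamiltonian L j a hL n w (fun y => h (Torus.reflectBetweenSites j a y))
    with hB
  set M := heisWeightedCrossOp L j a hL n w h with hM
  set N := heisWeightedCrossOp L j a hL n w (fun y => h (Torus.reflectBetweenSites j a y)) with hN
  set e := torusSplit (q := n + 1) L j a hL with he
  have hK : heisWeightedRealFieldHamiltonian L n w h =
      (A ⊗ₖ 1 + 1 ⊗ₖ B - ∑ i, M i ⊗ₖ N i).submatrix e e :=
    heisWeightedRealFieldHamiltonian_eq_submatrix L j a hL n hw0 hwθ h
  have hKL : heisWeightedRealFieldHamiltonian L n w (reflectFieldLeft L j a h) =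
      (A ⊗ₖ 1 + 1 ⊗ₖ A - ∑ i, M i ⊗ₖ M i).submatrix e e := by
    rw [heisWeightedRealFieldHamiltonian_eq_submatrix L j a hL n hw0 hwθ,
      heisWeightedLeftHamiltonian_congr w (fun x hx => reflectFieldLeft_of_mem L j a h hx),
      heisWeightedLeftHamiltonian_congr w
        (fun x hx => reflectFieldLeft_reflectBetweenSites_of_mem L j a hL h hx),
      heisWeightedCrossOp_congr w (fun x hx => reflectFieldLeft_of_mem L j a h hx),
      heisWeightedCrossOp_congr w
        (fun x hx => reflectFieldLeft_reflectBetweenSites_of_mem L j a hL h hx)]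
  have hKR : heisWeightedRealFieldHamiltonian L n w (reflectFieldRight L j a h) =
      (B ⊗ₖ 1 + 1 ⊗ₖ B - ∑ i, N i ⊗ₖ N i).submatrix e e := by
    rw [heisWeightedRealFieldHamiltonian_eq_submatrix L j a hL n hw0 hwθ,
      heisWeightedLeftHamiltonian_congr w (fun x hx => reflectFieldRight_of_mem L j a h hx),
      heisWeightedLeftHamiltonian_congr w
        (h₁ := fun y => reflectFieldRight L j a h (Torus.reflectBetweenSites j a y))
        (fun x hx => reflectFieldRight_reflectBetweenSites_of_mem L j a hL h hx),
      heisWeightedCrossOp_congr w (fun x hx => reflectFieldRight_of_mem L j a h hx),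
      heisWeightedCrossOp_congr w
        (h₁ := fun y => reflectFieldRight L j a h (Torus.reflectBetweenSites j a y))
        (fun x hx => reflectFieldRight_reflectBetweenSites_of_mem L j a hL h hx)]
  -- partition functions as traces of exponentials of the DLS forms
  have hZ : ∀ (X Y : Op (torusLeftHalf L j a) (n + 1))
      (P Q : torusCrossSites L j a × Bool ⊕ torusCrossSites L j a → Op (torusLeftHalf L j a) (n + 1)),
      partitionFn β ((X ⊗ₖ (1 : Op (torusLeftHalf L j a) (n + 1)) +
        (1 : Op (torusLeftHalf L j a) (n + 1)) ⊗ₖ Y - ∑ i, P i ⊗ₖ Q i).submatrix e e) =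
      (exp ((-(β : ℂ) • X) ⊗ₖ (1 : Op (torusLeftHalf L j a) (n + 1)) +
        (1 : Op (torusLeftHalf L j a) (n + 1)) ⊗ₖ (-(β : ℂ) • Y) +
        ∑ i, ((Real.sqrt β : ℂ) • P i) ⊗ₖ ((Real.sqrt β : ℂ) • Q i))).trace := by
    intro X Y P Q
    rw [partitionFn_submatrix_equiv, partitionFn, gibbsWeight, neg_smul_kroneckerForm hβ.le]
  -- reality
  have hnegβ : ∀ {X : Op (torusLeftHalf L j a) (n + 1)}, Xᵀ = Xᴴ →
      (-(β : ℂ) • X)ᵀ = (-(β : ℂ) • X)ᴴ := by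
    intro X hX
    have h := transpose_eq_conjTranspose_ofReal_smul hX (-β)
    rwa [Complex.ofReal_neg] at h
  have hAt : (-(β : ℂ) • A)ᵀ = (-(β : ℂ) • A)ᴴ :=
    hnegβ (heisWeightedLeftHamiltonian_transpose_eq w h)
  have hBt : (-(β : ℂ) • B)ᵀ = (-(β : ℂ) • B)ᴴ :=
    hnegβ (heisWeightedLeftHamiltonian_transpose_eq w _)
  have hMt : ∀ i, ((Real.sqrt β : ℂ) • M i)ᵀ = ((Real.sqrt β : ℂ) • M i)ᴴ := fun i =>
    transpose_eq_conjTranspose_ofReal_smul (heisWeightedCrossOp_transpose_eq w h i) _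
  have hNt : ∀ i, ((Real.sqrt β : ℂ) • N i)ᵀ = ((Real.sqrt β : ℂ) • N i)ᴴ := fun i =>
    transpose_eq_conjTranspose_ofReal_smul (heisWeightedCrossOp_transpose_eq w _ i) _
  haveI : Nonempty (torusLeftHalf L j a → Fin (n + 1)) := ⟨fun _ => 0⟩
  have hDLS := Matrix.trace_exp_kroneckerSum_le (m := torusLeftHalf L j a → Fin (n + 1))
    (n := torusLeftHalf L j a → Fin (n + 1)) hAt hBt hMt hNt
  have hineq : (partitionFn β (heisWeightedFieldHamiltonian L n w h)).re ≤
      Real.sqrt (partitionFn β (heisWeightedFieldHamiltonian L n w (reflectFieldLeft L j a h))).re *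
      Real.sqrt (partitionFn β (heisWeightedFieldHamiltonian L n w (reflectFieldRight L j a h))).re := by
    rw [partitionFn_heisWeightedFieldHamiltonian_eq L hL hL3,
      partitionFn_heisWeightedFieldHamiltonian_eq L hL hL3,
      partitionFn_heisWeightedFieldHamiltonian_eq L hL hL3, hK, hKL, hKR, hZ, hZ, hZ]
    exact hDLS
  calc _ ≤ (Real.sqrt (partitionFn β (heisWeightedFieldHamiltonian L n w (reflectFieldLeft L j a h))).re *
      Real.sqrt (partitionFn β (heisWeightedFieldHamiltonian L n w (reflectFieldRight L j a h))).re) ^ 2 :=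
        pow_le_pow_left₀ hx0.le hineq 2
    _ = _ := by rw [mul_pow, Real.sq_sqrt hy0.le, Real.sq_sqrt hz0.le]

end Reflection

/-! ### The descent, once: Gaussian domination from the reflection inequality -/

section Descent

variable (L : ℕ) [NeZero L]

/-- A bad bond of a field with positive bad-bond count, as a pair `(x₀, i)` with
`h_{x₀} ≠ h_{x₀ + eᵢ}`. [folklore] -/
private theorem exists_bad_pair' {h : TorusSite d L → ℝ} (hN : badBondCount L h ≠ 0) :
    ∃ (x₀ : TorusSite d L) (i : Fin d), h x₀ ≠ h (x₀ + Pi.single i 1) := by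
  classical
  obtain ⟨e, he⟩ := Finset.card_ne_zero.1 hN
  obtain ⟨heE, hbe⟩ := mem_filter.1 he
  revert heE hbe
  refine Sym2.ind (fun u v => ?_) e
  intro heE hbe
  rw [SimpleGraph.mem_edgeFinset, SimpleGraph.mem_edgeSet, torusGraph_adj_iff] at heE
  rw [Sym2.map_mk, Sym2.mk_isDiag_iff] at hbe
  obtain ⟨-, ⟨i, rfl⟩ | ⟨i, rfl⟩⟩ := heE
  · exact ⟨u, i, hbe⟩
  · exact ⟨v, i, fun h' => hbe h'.symm⟩

/-- **The descent of Kennedy–Lieb–Shastry, abstractly** ([KLS1988JSP] pp. 1027–1029; [DLS1978]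
proof of Thm. 4.2): on the even torus of side `L ≥ 4`, let `E` be ANY real function of the real
fields `h` on the sites such that (i) along every pair of planes
`½E(h^L) + ½E(h^R) ≤ E(h)` (the reflection inequality) and (ii) `E(h) = E(0)` whenever `h` is
constant on every bond (no bad bonds). Then `E(0) ≤ E(g)` for every field `g`. Proof as printed:
minimise `E` over the finitely many fields with values in the range of `g`, then the number of bad
bonds; a bad bond and the planes through it give two reflected minimisers one of which has fewer
bad bonds (`badBondCount_reflect`) — contradiction; so the minimiser has no bad bond and
`E(min) = E(0)`. (In the tree this argument is repeated inside each Gaussian-domination file; here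
it is stated once, for the ground-state energy `E = E₀(H(·))` and for `E = -Z_β(H(·))` alike.)
[cite: KLS1988JSP, eq. (18), pp. 1027–1029] [cite: DLS1978, Thm. 4.2 (proof)] -/
theorem gaussianDomination_descent (hL : Even L) (h4 : 4 ≤ L) (E : (TorusSite d L → ℝ) → ℝ)
    (hRP : ∀ (j : Fin d) (a : ZMod L) (h : TorusSite d L → ℝ),
      (E (reflectFieldLeft L j a h) + E (reflectFieldRight L j a h)) / 2 ≤ E h)
    (h0 : ∀ h : TorusSite d L → ℝ, badBondCount L h = 0 → E h = E (fun _ => 0))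
    (g : TorusSite d L → ℝ) : E (fun _ => 0) ≤ E g := by
  classical
  have hL2 : 2 ≤ L := by omega
  -- the finite search space
  set V : Finset ℝ := (univ : Finset (TorusSite d L)).image g with hV
  set Ef : (TorusSite d L → V) → ℝ := fun f => E (fun x => (f x : ℝ)) with hEf
  set Nf : (TorusSite d L → V) → ℕ := fun f => badBondCount L (fun x => (f x : ℝ)) with hNf
  set g' : TorusSite d L → V := fun x => ⟨g x, mem_image_of_mem g (mem_univ x)⟩ with hg'
  haveI : Nonempty (TorusSite d L → V) := ⟨g'⟩
  obtain ⟨f₀, hf₀⟩ := Finite.exists_min Ef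
  set S : Finset (TorusSite d L → V) := univ.filter fun f => Ef f = Ef f₀ with hS
  obtain ⟨f₁, hf₁S, hf₁min⟩ := S.exists_min_image Nf ⟨f₀, by simp [hS]⟩
  have hEf₁ : Ef f₁ = Ef f₀ := (mem_filter.1 hf₁S).2
  -- the minimiser has no bad bonds
  have hN0 : Nf f₁ = 0 := by
    by_contra hN
    obtain ⟨x₀, i, hbad⟩ := exists_bad_pair' L hN
    -- the planes through the bad bond
    set j := i
    obtain ⟨hxCS, hθx⟩ := add_single_mem_torusCrossSites L hL2 j x₀
    set a : ZMod L := x₀ j with ha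
    set φ : TorusSite d L → ℝ := fun x => (f₁ x : ℝ) with hφ
    set fL : TorusSite d L → V := fun y =>
      if y ∈ torusLeftHalf L j a then f₁ y else f₁ (Torus.reflectBetweenSites j a y) with hfL
    set fR : TorusSite d L → V := fun y =>
      if y ∈ torusLeftHalf L j a then f₁ (Torus.reflectBetweenSites j a y) else f₁ y with hfR
    have hfLφ : (fun x => (fL x : ℝ)) = reflectFieldLeft L j a φ := by
      funext y
      simp only [hfL, reflectFieldLeft, hφ]
      split_ifs <;> rfl
    have hfRφ : (fun x => (fR x : ℝ)) = reflectFieldRight L j a φ := by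
      funext y
      simp only [hfR, reflectFieldRight, hφ]
      split_ifs <;> rfl
    -- energies: both reflected fields are minimisers
    have hRP' := hRP j a φ
    have hEL : Ef fL = E (reflectFieldLeft L j a φ) := by simp only [hEf, hfLφ]
    have hER : Ef fR = E (reflectFieldRight L j a φ) := by simp only [hEf, hfRφ]
    have hE1 : Ef f₁ = E φ := by simp only [hEf, hφ]
    have h1 := hf₀ fL
    have h2 := hf₀ fR
    rw [← hEL, ← hER, ← hE1, hEf₁] at hRP'
    have hELm : Ef fL = Ef f₀ := by linarith
    have hERm : Ef fR = Ef f₀ := by linarith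
    have hNL : Nf f₁ ≤ Nf fL := hf₁min fL (by simp [hS, hELm])
    have hNR : Nf f₁ ≤ Nf fR := hf₁min fR (by simp [hS, hERm])
    -- counting: `N(f^L) + N(f^R) + 2N_C = 2N(f)` with `N_C ≥ 1`
    have hcount := badBondCount_reflect L j a hL φ
    have hNLφ : Nf fL = badBondCount L (reflectFieldLeft L j a φ) := by simp only [hNf, hfLφ]
    have hNRφ : Nf fR = badBondCount L (reflectFieldRight L j a φ) := by simp only [hNf, hfRφ]
    have hN1φ : Nf f₁ = badBondCount L φ := by simp only [hNf, hφ]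
    have hC : 1 ≤ ∑ x ∈ torusCrossSites L j a,
        (if (Sym2.map φ s(x, Torus.reflectBetweenSites j a x)).IsDiag then 0 else 1) := by
      have hone : (if (Sym2.map φ s(x₀ + Pi.single j 1,
          Torus.reflectBetweenSites j a (x₀ + Pi.single j 1))).IsDiag then 0 else 1) = 1 := by
        simp only [hθx, Sym2.map_mk, Sym2.mk_isDiag_iff]
        rw [if_neg]
        exact fun h' => hbad h'.symm
      calc 1 = (if (Sym2.map φ s(x₀ + Pi.single j 1,
          Torus.reflectBetweenSites j a (x₀ + Pi.single j 1))).IsDiag then 0 else 1) := hone.symm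
        _ ≤ _ := Finset.single_le_sum (f := fun x =>
          if (Sym2.map φ s(x, Torus.reflectBetweenSites j a x)).IsDiag then 0 else 1)
          (fun _ _ => Nat.zero_le _) hxCS
    rw [← hNLφ, ← hNRφ, ← hN1φ] at hcount
    omega
  -- hence `E(f₁) = E(0)` and `E(0) = E(f₁) ≤ E(g)`
  have h1 : Ef f₁ = E (fun _ => 0) := by
    simp only [hEf]
    exact h0 _ hN0
  have hEg : Ef g' = E g := by simp only [hEf, hg']
  rw [← hEg, ← h1, hEf₁]
  exact hf₀ g'

variable (n : ℕ)

/-- `x² ≤ yz` with `y, z ≥ 0` gives `x ≤ ½(y + z)` (geometric–arithmetic mean). [folklore] -/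
private theorem le_half_add_of_sq_le_mul {x y z : ℝ} (hy : 0 ≤ y) (hz : 0 ≤ z)
    (h : x ^ 2 ≤ y * z) : x ≤ (y + z) / 2 := by
  nlinarith [sq_nonneg (y - z), h, hy, hz, sq_nonneg (x - (y + z) / 2)]

/-- **Ground-state Gaussian domination for the antiferromagnet with reflection-invariant
nonnegative bond weights** ([KLS1988JSP] eq. (18) for the couplings of eq. (5)): on the even torus
of side `L ≥ 4`, for every spin, every weight `w ≥ 0` with `w(θe) = w(e)` for all the reflections
through bond planes, and every real field `h`, `E₀(H_w) ≤ E₀(H_w(h))`.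
[cite: KLS1988JSP, eqs. (5), (18), pp. 1027–1029] -/
theorem heisWeighted_gaussianDomination_ground (hL : Even L) (h4 : 4 ≤ L)
    {w : Sym2 (TorusSite d L) → ℝ} (hw0 : ∀ e, 0 ≤ w e)
    (hwθ : ∀ (j : Fin d) (a : ZMod L) (e : Sym2 (TorusSite d L)),
      w (e.map (Torus.reflectBetweenSites j a)) = w e)
    (g : TorusSite d L → ℝ) :
    (heisWeightedHamiltonian L n w).groundEnergy ≤
      (heisWeightedFieldHamiltonian L n w g).groundEnergy := by
  have hL3 : 3 ≤ L := by omega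
  have h := gaussianDomination_descent L hL h4
    (fun f => (heisWeightedFieldHamiltonian L n w f).groundEnergy)
    (fun j a f => heis_groundEnergy_reflect_le_weighted L j a n hL hL3 hw0 (hwθ j a) f)
    (fun f hf => by
      simp only [heisWeightedFieldHamiltonian_eq_of_badBondCount_eq_zero L n w hf,
        heisWeightedFieldHamiltonian_zero]) g
  simpa only [heisWeightedFieldHamiltonian_zero] using h

/-- **Gaussian domination at positive temperature for the antiferromagnet with reflection-invariant
nonnegative bond weights** ([DLS1978] Thm. 4.2 / Thm. 6.1 for the couplings of [KLS1988JSP]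
eq. (5) — the combination announced on [KLS1988JSP] p. 1020): on the even torus of side `L ≥ 4`,
for every spin, every `β > 0`, every weight `w ≥ 0` with `w(θe) = w(e)` for all reflections through
bond planes, and every real field `h`, `Z_β(H_w(h)) ≤ Z_β(H_w)`. Proof: the descent applied to
`E = -Z_β(H_w(·))`, the reflection inequality being `Z(h) ≤ √(Z(h^L)Z(h^R)) ≤ ½(Z(h^L) + Z(h^R))`.
[cite: DLS1978, Thm. 4.2, Thm. 6.1] [cite: KLS1988JSP, p. 1020, eq. (5)] -/
theorem partitionFn_heisWeightedField_le (hL : Even L) (h4 : 4 ≤ L) {β : ℝ} (hβ : 0 < β)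
    {w : Sym2 (TorusSite d L) → ℝ} (hw0 : ∀ e, 0 ≤ w e)
    (hwθ : ∀ (j : Fin d) (a : ZMod L) (e : Sym2 (TorusSite d L)),
      w (e.map (Torus.reflectBetweenSites j a)) = w e)
    (g : TorusSite d L → ℝ) :
    (partitionFn β (heisWeightedFieldHamiltonian L n w g)).re ≤
      (partitionFn β (heisWeightedHamiltonian L n w)).re := by
  have hL3 : 3 ≤ L := by omega
  have hZpos : ∀ f : TorusSite d L → ℝ,
      0 < (partitionFn β (heisWeightedFieldHamiltonian L n w f)).re :=
    fun f => (partitionFn_re_pos β (heisWeightedFieldHamiltonian_isHermitian L n w f)).1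
  have h := gaussianDomination_descent L hL h4
    (fun f => -(partitionFn β (heisWeightedFieldHamiltonian L n w f)).re)
    (fun j a f => by
      -- `Z(f)² ≤ Z(f^L)Z(f^R)` hence `Z(f) ≤ ½(Z(f^L) + Z(f^R))`
      have h3 := le_half_add_of_sq_le_mul (hZpos (reflectFieldLeft L j a f)).le
        (hZpos (reflectFieldRight L j a f)).le
        (heis_partitionFn_weighted_sq_le L j a n hL hL3 hβ hw0 (hwθ j a) f)
      linarith)
    (fun f hf => by
      simp only [heisWeightedFieldHamiltonian_eq_of_badBondCount_eq_zero L n w hf,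
        heisWeightedFieldHamiltonian_zero]) g
  simp only [heisWeightedFieldHamiltonian_zero] at h
  linarith

end Descent

/-! ### Direction-dependent nearest-neighbour couplings -/

section DirCoupling

variable (L : ℕ) [NeZero L] (n : ℕ)

/-- **The Heisenberg antiferromagnet with direction-dependent couplings**
`H_K = Σ_x Σᵢ Kᵢ 𝐒_x·𝐒_{x+eᵢ}` on `(ℤ/Lℤ)^d`, spin `n/2` — [KLS1988JSP] eq. (5) (`K = (1, 1, r)`:
"the model that interpolates between two and three dimensions"). [cite: KLS1988JSP, eq. (5)] -/
def heisAnisoTorus (K : Fin d → ℝ) : Op (TorusSite d L) (n + 1) :=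
  heisWeightedHamiltonian L n (dirCoupling L K)

/-- The field Hamiltonian of the anisotropic antiferromagnet,
`H_K(h) = Σ_x Σᵢ Kᵢ [𝐒_x·𝐒_{x+eᵢ} - (h_x - h_{x+eᵢ})(S̃¹_x - S̃¹_{x+eᵢ}) + ½(h_x - h_{x+eᵢ})²]`
([KLS1988JSP] eq. (17) for the couplings (5), original frame). [cite: KLS1988JSP, eqs. (5), (17)] -/
def heisAnisoFieldHamiltonian (K : Fin d → ℝ) (h : TorusSite d L → ℝ) :
    Op (TorusSite d L) (n + 1) :=
  heisWeightedFieldHamiltonian L n (dirCoupling L K) h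

/-- The anisotropic staggered gradient coupling
`V_K(h) = Σ_x Σᵢ Kᵢ (h_x - h_{x+eᵢ})(S̃¹_x - S̃¹_{x+eᵢ})` (the term linear in `h`; the tree's
`heisStagGradField` for `K ≡ 1`). [cite: KLS1988JSP, eq. (17)] -/
def heisAnisoStagGradField (K : Fin d → ℝ) (h : TorusSite d L → ℝ) : Op (TorusSite d L) (n + 1) :=
  ∑ x : TorusSite d L, ∑ i : Fin d,
    ((K i * (h x - h (x + Pi.single i 1)) : ℝ) : ℂ) •
      (stagSiteSpinX L n x - stagSiteSpinX L n (x + Pi.single i 1))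

/-- **`H_K` as a sum over sites and directions** (`L ≥ 3`): `H_K = Σ_x Σᵢ Kᵢ 𝐒_x·𝐒_{x+eᵢ}`.
[cite: KLS1988JSP, eq. (5)] -/
theorem heisAnisoTorus_eq_sum (hL3 : 3 ≤ L) (K : Fin d → ℝ) :
    heisAnisoTorus L n K =
      ∑ x : TorusSite d L, ∑ i : Fin d, ((K i : ℝ) : ℂ) • spinDot n x (x + Pi.single i 1) := by
  unfold heisAnisoTorus heisWeightedHamiltonian
  rw [← sum_pairs_eq_sum_edgeFinset' L hL3]
  simp only [spinDotSym_mk, dirCoupling_mk_add_single L hL3]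

/-- **`H_K(h) = H_K - V_K(h) + ½Q_K(h)`** (`L ≥ 3`): the anisotropic field Hamiltonian in the form
of the tree's `heisFieldHamiltonian`, with the anisotropic Dirichlet form `xyAnisoFieldEnergy`.
[cite: KLS1988JSP, eq. (17)] -/
theorem heisAnisoFieldHamiltonian_eq (hL3 : 3 ≤ L) (K : Fin d → ℝ) (h : TorusSite d L → ℝ) :
    heisAnisoFieldHamiltonian L n K h =
      heisAnisoTorus L n K - heisAnisoStagGradField L n K h +
        ((xyAnisoFieldEnergy L K h / 2 : ℝ) : ℂ) • (1 : Op (TorusSite d L) (n + 1)) := by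
  unfold heisAnisoFieldHamiltonian heisWeightedFieldHamiltonian heisAnisoStagGradField
    xyAnisoFieldEnergy
  rw [heisAnisoTorus_eq_sum L n hL3, ← sum_pairs_eq_sum_edgeFinset' L hL3]
  simp only [Sym2.lift_mk, dirCoupling_mk_add_single L hL3, heisFieldBond]
  rw [sum_div, Complex.ofReal_sum, sum_smul]
  simp_rw [sum_div, Complex.ofReal_sum, sum_smul]
  rw [← sum_sub_distrib, ← sum_add_distrib]
  refine sum_congr rfl fun x _ => ?_
  rw [← sum_sub_distrib, ← sum_add_distrib]
  refine sum_congr rfl fun i _ => ?_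
  rw [smul_add, smul_sub, smul_smul, smul_smul, ← Complex.ofReal_mul, ← Complex.ofReal_mul,
    show K i * ((h x - h (x + Pi.single i 1)) ^ 2 / 2) =
      K i * (h x - h (x + Pi.single i 1)) ^ 2 / 2 by ring, spinDot, Fin.sum_univ_three]

/-- `H_K(0) = H_K` ([KLS1988JSP] after eq. (17)). [cite: KLS1988JSP, eq. (17)] -/
theorem heisAnisoFieldHamiltonian_zero (K : Fin d → ℝ) :
    heisAnisoFieldHamiltonian L n K (fun _ => 0) = heisAnisoTorus L n K :=
  heisWeightedFieldHamiltonian_zero L n _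

/-- **Consistency with the isotropic model**: `H_{(1,…,1)} = heisenbergTorus d L n 1` (`L ≥ 3`).
[cite: KLS1988JSP, eq. (5)] -/
theorem heisAnisoTorus_one (hL3 : 3 ≤ L) :
    heisAnisoTorus L n (fun _ : Fin d => (1 : ℝ)) = heisenbergTorus d L n 1 := by
  unfold heisAnisoTorus heisWeightedHamiltonian
  rw [heisenbergTorus_one_eq_sum]
  refine sum_congr rfl fun e he => ?_
  rw [dirCoupling_const_of_mem L hL3 1 he, Complex.ofReal_one, one_smul]

/-- **Consistency with the isotropic field Hamiltonian**: `H_{(1,…,1)}(h) = heisFieldHamiltonian L n h`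
on the even torus of side `L = 2k ≥ 3`. [cite: KLS1988JSP, eq. (17)] -/
theorem heisAnisoFieldHamiltonian_one (k : ℕ) [NeZero (2 * k)] (hL3 : 3 ≤ 2 * k)
    (h : TorusSite d (2 * k) → ℝ) :
    heisAnisoFieldHamiltonian (2 * k) n (fun _ : Fin d => (1 : ℝ)) h =
      heisFieldHamiltonian (2 * k) n h := by
  unfold heisAnisoFieldHamiltonian heisWeightedFieldHamiltonian
  rw [heisFieldHamiltonian_eq_edgeSum k n hL3]
  refine sum_congr rfl fun e he => ?_
  rw [dirCoupling_const_of_mem (2 * k) hL3 1 he, Complex.ofReal_one, one_smul]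
  induction e using Sym2.ind with
  | h x y => simp only [Sym2.lift_mk, heisFieldBond]

/-- `H_K` is Hermitian. [cite: KLS1988JSP, eq. (5)] -/
theorem heisAnisoTorus_isHermitian (K : Fin d → ℝ) : (heisAnisoTorus L n K).IsHermitian :=
  heisWeightedHamiltonian_isHermitian L n _

/-- `H_K(h)` is Hermitian. [cite: KLS1988JSP, eq. (17)] -/
theorem heisAnisoFieldHamiltonian_isHermitian (K : Fin d → ℝ) (h : TorusSite d L → ℝ) :
    (heisAnisoFieldHamiltonian L n K h).IsHermitian :=
  heisWeightedFieldHamiltonian_isHermitian L n _ h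

/-- **Ground-state Gaussian domination for the antiferromagnet with direction-dependent
couplings** ([KLS1988JSP] eq. (18) for the model (5); "For the model (5) … the bound (14) holds
with `E_{q-Q}` replaced by `E^r_{q-Q}`", p. 1026): on the even torus of side `L ≥ 4`, for every
spin, every `K ≥ 0` and every real field `h`, `E₀(H_K) ≤ E₀(H_K(h))`.
[cite: KLS1988JSP, eqs. (5), (18), p. 1026] -/
theorem heisAniso_gaussianDomination_ground (hL : Even L) (h4 : 4 ≤ L) {K : Fin d → ℝ}
    (hK : ∀ i, 0 ≤ K i) (g : TorusSite d L → ℝ) :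
    (heisAnisoTorus L n K).groundEnergy ≤ (heisAnisoFieldHamiltonian L n K g).groundEnergy :=
  heisWeighted_gaussianDomination_ground L n hL h4 (dirCoupling_nonneg L hK)
    (fun j a e => dirCoupling_map_reflectBetweenSites L j a K e) g

/-- **Gaussian domination at positive temperature for the antiferromagnet with direction-dependent
couplings** ([DLS1978] Thm. 4.2 / Thm. 6.1 for the model of [KLS1988JSP] eq. (5) — the
combination announced on [KLS1988JSP] p. 1020: "the techniques we use may be combined with the
techniques of Dyson et al. for nonzero temperatures to prove the existence of a phase transition
for `1 ≥ r ≥ 0.16`"): on the even torus of side `L ≥ 4`, for every spin, every `β > 0`, every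
`K ≥ 0` and every real field `h`, `Z_β(H_K(h)) ≤ Z_β(H_K)`.
[cite: DLS1978, Thm. 4.2, Thm. 6.1] [cite: KLS1988JSP, p. 1020, eq. (5)] -/
theorem partitionFn_heisAnisoField_le (hL : Even L) (h4 : 4 ≤ L) {β : ℝ} (hβ : 0 < β)
    {K : Fin d → ℝ} (hK : ∀ i, 0 ≤ K i) (g : TorusSite d L → ℝ) :
    (partitionFn β (heisAnisoFieldHamiltonian L n K g)).re ≤
      (partitionFn β (heisAnisoTorus L n K)).re :=
  partitionFn_heisWeightedField_le L n hL h4 hβ (dirCoupling_nonneg L hK)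
    (fun j a e => dirCoupling_map_reflectBetweenSites L j a K e) g

/-- The isotropic special case recovers the tree's ground-state Gaussian domination
`heis_gaussianDomination_ground` (consistency check). [cite: KLS1988JSP, eq. (18)] -/
theorem heisAniso_gaussianDomination_ground_one (k : ℕ) [NeZero (2 * k)] (h4 : 4 ≤ 2 * k)
    (g : TorusSite d (2 * k) → ℝ) :
    (heisenbergTorus d (2 * k) n 1).groundEnergy ≤ (heisFieldHamiltonian (2 * k) n g).groundEnergy := by
  have hL3 : 3 ≤ 2 * k := by omega
  rw [← heisAnisoTorus_one (2 * k) n hL3, ← heisAnisoFieldHamiltonian_one n k hL3]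
  exact heisAniso_gaussianDomination_ground (2 * k) n (even_two_mul k) h4 (fun _ => zero_le_one) g

end DirCoupling

end Literature.MathematicalPhysics.QuantumLattice
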